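import Summits.QuantumFields.YangMills.Theorems.LangevinControlUVOSLegsFromFemtoAndGapDefsR3
import Summits.QuantumFields.YangMills.Theorems.LangevinControlUVOSLegsFromFemtoAndGapStubGap
import HarnessLib

/-!
# Stub `stub_rope` of line `Sketch` (crux `OSLegsAtWeakCouplingC`, stmt-QuantumFields-16207) — helper III:
# hermiticity on positive-time off-diagonal test functions from `RPPos`

Helper file for stub `stub_rope` (DefsR3 §4.4).  The rope identifies the limit of the lattice reflected
autocorrelation `osCorr` of the smeared field of a real test function `F` with `S(ΘF* ⊗ T_tF) − conj(S F) · S F`,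
whereas the connected OS form `conn` of DefsR3 subtracts `S(ΘF*) · S(T_tF)`; the two agree by hermiticity
`S(ΘF*) = conj S(F)`.  Toolkit XXII proves hermiticity from E0 + E2 for TIME-ORDERED `F`; here the same two-term
tuple `(c·𝟙₀, F)` is fed to `RPPos` (E2 on positive-time off-diagonal tuples), which is what `Decay` quantifies over:
* `apply_eq_conj_osAdjoint_of_rpPos` — `S₁ n F = conj (S₁ n (ΘF*))` for positive-time off-diagonal `F`.
-/

noncomputable section

open scoped SchwartzMap BigOperators ComplexConjugate
open Filter Topology
open Literature.MathematicalPhysics.QuantumLattice Literature.MathematicalPhysics.AQFT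
open Summit.QuantumFields.YangMills.Cruxes.OSLegsFromFemtoAndGap.DlrCollarTransfer (RPPos)

namespace Summit.QuantumFields.YangMills.Theorems.OSLegsFromFemtoAndGap

-- adapted from toolkit XXII `isHermitian_of_isReflectionPositive` (E2 on time-ordered ↦ `RPPos`)
/-- **Hermiticity from `RPPos` and `S₁ 0 = ev`**: `S₁ₙ(F) = conj S₁ₙ(ΘF*)` for every positive-time off-diagonal `F`
(apply `RPPos` to the two-term tuple `(c·𝟙₀, F)`; the OS form `|c|² + c̄·S(F) + c·S(ΘF*) + S(ΘF* ⊗ F)` is real for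
`c = 0, 1, i`). -/
theorem apply_eq_conj_osAdjoint_of_rpPos' (S₁ : SchwingerFamily (EuclideanSpace ℝ (Fin 4))) (hN : ∀ F : 𝓢((Fin 0 → (EuclideanSpace ℝ (Fin 4))), ℂ), S₁ 0 F = F default)
    (hRP : RPPos S₁) {n : ℕ} {F : 𝓢((Fin n → (EuclideanSpace ℝ (Fin 4))), ℂ)} (hF : IsPositiveTimeMulti F) (hFo : IsOffDiagonal F) :
    S₁ n F = conj (S₁ n (osAdjoint F)) := by
  -- the two-term tuple `(c·𝟙₀, F)` and its OS form
  have key : ∀ c : ℂ, (conj c * c + conj c * S₁ n F + c * S₁ n (osAdjoint F) +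
      S₁ (n + n) ((osAdjoint F).appendTensor F)).im = 0 := by
    intro c
    let deg : Fin 2 → ℕ := Fin.cons 0 fun _ => n
    let F' : (j : Fin 2) → 𝓢((Fin (deg j) → (EuclideanSpace ℝ (Fin 4))), ℂ) :=
      Fin.cons (α := fun j : Fin 2 => 𝓢((Fin (deg j) → (EuclideanSpace ℝ (Fin 4))), ℂ))
        (SchwartzMap.constOfSubsingleton (D := Fin 0 → (EuclideanSpace ℝ (Fin 4))) c) fun _ => F
    have hpos : ∀ j, IsPositiveTimeMulti (F' j) := fun j => Fin.cases (isPositiveTimeMulti_const c) (fun _ => hF) j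
    have hoff : ∀ j, IsOffDiagonal (F' j) := fun j => Fin.cases (isOffDiagonal_const c) (fun _ => hFo) j
    have h := hRP 2 deg F' hpos hoff (fun i j => (osAdjoint (F' i)).appendTensor (F' j))
      (fun i j x => SchwartzMap.appendTensor_apply _ _ x)
    simp only [Fin.sum_univ_two] at h
    -- identify the four terms
    have h00 : S₁ (deg 0 + deg 0) ((osAdjoint (F' 0)).appendTensor (F' 0)) = conj c * c := by
      refine (hN ((osAdjoint (F' 0)).appendTensor (F' 0))).trans ((SchwartzMap.appendTensor_apply _ _ _).trans ?_)
      change osAdjoint (SchwartzMap.constOfSubsingleton (D := Fin 0 → (EuclideanSpace ℝ (Fin 4))) c) _ *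
        SchwartzMap.constOfSubsingleton (D := Fin 0 → (EuclideanSpace ℝ (Fin 4))) c _ = _
      rw [osAdjoint_const_apply, SchwartzMap.constOfSubsingleton_apply]
    have h01 : S₁ (deg 0 + deg 1) ((osAdjoint (F' 0)).appendTensor (F' 1)) = conj c * S₁ n F := by
      refine (schwinger_castTest S₁ (m := 0 + n) (Nat.zero_add n) ((osAdjoint (F' 0)).appendTensor (F' 1))).trans ?_
      have hG : castTest (Nat.zero_add n) ((osAdjoint (F' 0)).appendTensor (F' 1)) = conj c • F := by
        ext x
        refine (SchwartzMap.appendTensor_apply _ _ _).trans ?_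
        change osAdjoint (SchwartzMap.constOfSubsingleton (D := Fin 0 → (EuclideanSpace ℝ (Fin 4))) c) _ * F _ = _
        rw [osAdjoint_const_apply, smul_apply, smul_eq_mul]
        congr 1
        congr 1
        funext i
        simp only [Function.comp_apply]
        change x (Fin.cast (Nat.zero_add n) (Fin.natAdd 0 i)) = x i
        congr 1
        refine Fin.ext ?_
        rw [Fin.val_cast, Fin.val_natAdd]
        exact Nat.zero_add _
      rw [hG, map_smul, smul_eq_mul]
    have h10 : S₁ (deg 1 + deg 0) ((osAdjoint (F' 1)).appendTensor (F' 0)) = c * S₁ n (osAdjoint F) := by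
      refine (schwinger_castTest S₁ (m := n + 0) (Nat.add_zero n) ((osAdjoint (F' 1)).appendTensor (F' 0))).trans ?_
      have hG : castTest (Nat.add_zero n) ((osAdjoint (F' 1)).appendTensor (F' 0)) = c • osAdjoint F := by
        ext x
        refine (SchwartzMap.appendTensor_apply _ _ _).trans ?_
        change osAdjoint F _ * SchwartzMap.constOfSubsingleton (D := Fin 0 → (EuclideanSpace ℝ (Fin 4))) c _ = _
        rw [SchwartzMap.constOfSubsingleton_apply, smul_apply, smul_eq_mul, mul_comm]
        rfl
      rw [hG, map_smul, smul_eq_mul]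
    have h11 : S₁ (deg 1 + deg 1) ((osAdjoint (F' 1)).appendTensor (F' 1)) =
        S₁ (n + n) ((osAdjoint F).appendTensor F) := rfl
    rw [h00, h01, h10, h11] at h
    have := h.2
    rw [show conj c * c + conj c * S₁ n F + (c * S₁ n (osAdjoint F) + S₁ (n + n) ((osAdjoint F).appendTensor F)) =
      conj c * c + conj c * S₁ n F + c * S₁ n (osAdjoint F) + S₁ (n + n) ((osAdjoint F).appendTensor F) by ring] at this
    exact this
  have k0 := key 0
  have k1 := key 1
  have kI := key Complex.I
  simp only [map_zero, map_one, Complex.conj_I, zero_mul, mul_zero, zero_add, one_mul, neg_mul,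
    Complex.add_im, Complex.neg_im, Complex.mul_im, Complex.I_re, Complex.I_im,
    Complex.one_im, mul_one, add_zero] at k0 k1 kI
  apply Complex.ext
  · rw [Complex.conj_re]; linarith
  · rw [Complex.conj_im]; linarith

/-- **Hermiticity from `RPPos` and `S₁ 0 = ev`** (registered form): `S₁ₙ(F) = conj S₁ₙ(ΘF*)` for positive-time
off-diagonal `F`. -/
theorem apply_eq_conj_osAdjoint_of_rpPos : ∀ (S₁ : SchwingerFamily (EuclideanSpace ℝ (Fin 4))), (∀ F : SchwartzMap (Fin 0 → EuclideanSpace ℝ (Fin 4)) ℂ, S₁ 0 F = F default) → Summit.QuantumFields.YangMills.Cruxes.OSLegsFromFemtoAndGap.DlrCollarTransfer.RPPos S₁ → ∀ {n : ℕ} {F : SchwartzMap (Fin n → EuclideanSpace ℝ (Fin 4)) ℂ}, IsPositiveTimeMulti F → Literature.MathematicalPhysics.AQFT.IsOffDiagonal F → S₁ n F = (starRingEnd ℂ) (S₁ n (osAdjoint F)) :=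
  fun S₁ hN hRP _ _ hF hFo => apply_eq_conj_osAdjoint_of_rpPos' S₁ hN hRP hF hFo

end Summit.QuantumFields.YangMills.Theorems.OSLegsFromFemtoAndGap

end
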